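import Summits.NavierStokesRegularity.NavierStokesRegularity.Theses.HubbleDynamo
import Summits.NavierStokesRegularity.NavierStokesRegularity.Theorems.TypeIDSSLiouvilleConjecture
import Literature.Analysis.FluidPDE.SelfSimilar
import Literature.Analysis.FluidPDE.SelfSimilarLiouville
import HarnessLib

/-!
# Crux `NoSelfExcitedDynamo` (stmt-NavierStokesRegularity-1934): hardness certificate —
  the crux implies the catalogued open conjecture `TypeIDSSLiouvilleConjecture`

Theorems file (lands `--supports stmt-NavierStokesRegularity-1934`). The route text asserts
informally that the crux `NoSelfExcitedDynamo` (KNSS-class pointwise Type-I Liouville theorem for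
BOUNDED ancient mild solutions, `ν = 1`) "contains Tsai's Conj. 8.8 / `TypeIDSSLiouvilleConjecture`
(shift a backward DSS solution by one time unit: it becomes bounded on `(−∞,0)` and keeps
`HasTypeIDecay`)". This file proves it, in a slightly stronger form that needs no self-similarity:

* `hardness_unbounded_class`: under the crux, EVERY ancient mild solution (bounded or not near
  `t = 0`) with measurable slices and a pointwise Type-I bound `‖u(t,x)‖ ≤ C₀/(‖x‖ + √(−t))` has
  a.e.-zero slices — the Type-I bound makes `t ↦ u(t − τ)` bounded by `C₀/√τ` on `(−∞, 0)` for every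
  `τ > 0`, time translation preserves the ancient mild class (`IsAncientMildSolution.time_translate`)
  and the Type-I bound about the vertex `(0, 0)` (`√(τ − t) ≥ √(−t)`), so the crux kills `u` on
  `t < −τ`, for every `τ > 0`;
* `hardness_typeIDSSLiouville`, `hardness_rotatedTypeIDSSLiouville`: hence the plain and rotated
  Type-I `λ`-DSS Liouville statements (`TypeIDSSLiouville λ`, `RotatedTypeIDSSLiouville λ R`;
  Bradshaw–Tsai 2017, Open Problem 5.1; Tsai, Conjectures 8.8–8.9) for every `λ` and `R`;
* `typeIDSSLiouvilleConjecture_of_noSelfExcitedDynamo`: `NoSelfExcitedDynamo → TypeIDSSLiouvilleConjecture`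
  (the canonical `@[conjecture]` leaf `Summit.NavierStokesRegularity.NavierStokesRegularity.TypeIDSSLiouvilleConjecture`).

Consequently any proof of the crux proves that conjecture, and any Type-I (R)DSS profile
(`IsTypeIDSSProfile`, whose existence is Bradshaw–Tsai's open problem) refutes the crux
(`not_noSelfExcitedDynamo_of_not_typeIDSSLiouvilleConjecture`).
-/

noncomputable section

-- the stub namespace of this crux repeats `NavierStokesRegularity` (tree precedent)
set_option linter.dupNamespace false

namespace Summit.NavierStokesRegularity.NavierStokesRegularity.Theorems.NoSelfExcitedDynamo.Registered

open Set MeasureTheory Filter Topology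
open Literature.Analysis.FluidPDE

/-- A pointwise Type-I bound has a nonnegative constant (evaluate at any point of the past). -/
theorem hardness_typeI_const_nonneg {u : ℝ → EuclideanSpace ℝ (Fin 3) → EuclideanSpace ℝ (Fin 3)}
    {C₀ : ℝ} (hC : HasTypeIDecay C₀ u) : 0 ≤ C₀ := by
  have h := (norm_nonneg _).trans (hC (-1) (by norm_num) 0)
  have hden : (0 : ℝ) < ‖(0 : EuclideanSpace ℝ (Fin 3))‖ + Real.sqrt (-(-1)) := by
    rw [norm_zero, zero_add, neg_neg, Real.sqrt_one]; exact one_pos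
  exact (div_nonneg_iff.1 h).elim (fun h => h.1) fun h => absurd h.2 (not_le.2 hden)

/-- **Time translation into the past preserves the Type-I bound about the vertex `(0, 0)`**:
if `‖u(t, x)‖ ≤ C₀/(‖x‖ + √(−t))` on the past, then for `τ ≥ 0` the translated field
`t ↦ u(t − τ)` obeys the same bound (`√(τ − t) ≥ √(−t)`, `C₀ ≥ 0`). -/
theorem hardness_hasTypeIDecay_translate {u : ℝ → EuclideanSpace ℝ (Fin 3) → EuclideanSpace ℝ (Fin 3)}
    {C₀ : ℝ} (hC : HasTypeIDecay C₀ u) {τ : ℝ} (hτ : 0 ≤ τ) :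
    HasTypeIDecay C₀ (fun t => u (t + -τ)) := by
  intro t ht x
  have hC0 := hardness_typeI_const_nonneg hC
  have hst : 0 < Real.sqrt (-t) := Real.sqrt_pos.2 (by linarith)
  have key := hC (t + -τ) (by linarith) x
  have hsq : Real.sqrt (-t) ≤ Real.sqrt (-(t + -τ)) := Real.sqrt_le_sqrt (by linarith)
  have hden : ‖x‖ + Real.sqrt (-t) ≤ ‖x‖ + Real.sqrt (-(t + -τ)) := by linarith
  exact key.trans (div_le_div_of_nonneg_left hC0 (add_pos_of_nonneg_of_pos (norm_nonneg _) hst) hden)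

/-- **Time translation into the past makes a Type-I field bounded**: for `τ > 0` the translated
field `t ↦ u(t − τ)` is bounded by `C₀/√τ` on `(−∞, 0)`. -/
theorem hardness_isBoundedOn_translate {u : ℝ → EuclideanSpace ℝ (Fin 3) → EuclideanSpace ℝ (Fin 3)}
    {C₀ : ℝ} (hC : HasTypeIDecay C₀ u) {τ : ℝ} (hτ : 0 < τ) :
    IsBoundedOn (Iio 0) (fun t => u (t + -τ)) := by
  have hC0 := hardness_typeI_const_nonneg hC
  refine ⟨C₀ / Real.sqrt τ, fun t ht x => ?_⟩
  have ht0 : t < 0 := ht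
  have hsτ : 0 < Real.sqrt τ := Real.sqrt_pos.2 hτ
  have key := hC (t + -τ) (by linarith) x
  refine key.trans (div_le_div_of_nonneg_left hC0 hsτ ?_)
  calc Real.sqrt τ ≤ Real.sqrt (-(t + -τ)) := Real.sqrt_le_sqrt (by linarith)
    _ ≤ ‖x‖ + Real.sqrt (-(t + -τ)) := le_add_of_nonneg_left (norm_nonneg _)

/-- **The crux self-improves to the unbounded class.** If `NoSelfExcitedDynamo` holds (hypothesis
written unfolded), then every ancient mild solution `u` (`ν = 1`, duality form; NOT assumed bounded
near `t = 0`) with measurable slices and a pointwise Type-I bound has a.e.-zero slices: for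
`τ > 0` the translated field `t ↦ u(t − τ)` is a bounded ancient mild solution
(`IsAncientMildSolution.time_translate`, bound `C₀/√τ`) with measurable slices and the same Type-I
bound, so the crux gives `u(t − τ) = 0` a.e. for every `t < 0`; take `τ = −t/2`. -/
theorem hardness_unbounded_class
    (hcrux : ∀ u : ℝ → EuclideanSpace ℝ (Fin 3) → EuclideanSpace ℝ (Fin 3),
      IsBoundedAncientMildSolution 1 u →
      (∀ t < 0, AEStronglyMeasurable (u t) volume) → (∃ C : ℝ, HasTypeIDecay C u) →
      ∀ t < 0, u t =ᵐ[volume] (0 : EuclideanSpace ℝ (Fin 3) → EuclideanSpace ℝ (Fin 3)))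
    (u : ℝ → EuclideanSpace ℝ (Fin 3) → EuclideanSpace ℝ (Fin 3)) (hu : IsAncientMildSolution 1 u)
    (hmeas : ∀ t < 0, AEStronglyMeasurable (u t) volume) (hdec : ∃ C₀ : ℝ, HasTypeIDecay C₀ u) :
    ∀ t < 0, u t =ᵐ[volume] (0 : EuclideanSpace ℝ (Fin 3) → EuclideanSpace ℝ (Fin 3)) := by
  intro t ht
  obtain ⟨C₀, hC⟩ := hdec
  set τ : ℝ := -t / 2 with hτ_def
  have hτ : 0 < τ := by rw [hτ_def]; linarith
  have hmild : IsBoundedAncientMildSolution 1 (fun s => u (s + -τ)) :=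
    ⟨hu.time_translate (by linarith), hardness_isBoundedOn_translate hC hτ⟩
  have hmeas' : ∀ s < 0, AEStronglyMeasurable ((fun s => u (s + -τ)) s) volume :=
    fun s hs => hmeas (s + -τ) (by linarith)
  have key := hcrux (fun s => u (s + -τ)) hmild hmeas' ⟨C₀, hardness_hasTypeIDecay_translate hC hτ.le⟩
    (t + τ) (by rw [hτ_def]; linarith)
  simpa using key

/-- **The crux implies the plain Type-I `λ`-DSS Liouville statement** `TypeIDSSLiouville λ` for every
`λ` (Bradshaw–Tsai 2017, Open Problem 5.1; the self-similarity hypothesis is not even used). -/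
theorem hardness_typeIDSSLiouville
    (hcrux : ∀ u : ℝ → EuclideanSpace ℝ (Fin 3) → EuclideanSpace ℝ (Fin 3),
      IsBoundedAncientMildSolution 1 u →
      (∀ t < 0, AEStronglyMeasurable (u t) volume) → (∃ C : ℝ, HasTypeIDecay C u) →
      ∀ t < 0, u t =ᵐ[volume] (0 : EuclideanSpace ℝ (Fin 3) → EuclideanSpace ℝ (Fin 3)))
    (c : ℝ) : TypeIDSSLiouville c :=
  fun _ u hu hmeas _ hdec => hardness_unbounded_class hcrux u hu hmeas hdec

/-- **The crux implies the rotated Type-I `λ`-DSS Liouville statement** `RotatedTypeIDSSLiouville λ R`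
for every `λ` and every `R ∈ O(3)` (Bradshaw–Tsai 2017, Open Problem 5.1). -/
theorem hardness_rotatedTypeIDSSLiouville
    (hcrux : ∀ u : ℝ → EuclideanSpace ℝ (Fin 3) → EuclideanSpace ℝ (Fin 3),
      IsBoundedAncientMildSolution 1 u →
      (∀ t < 0, AEStronglyMeasurable (u t) volume) → (∃ C : ℝ, HasTypeIDecay C u) →
      ∀ t < 0, u t =ᵐ[volume] (0 : EuclideanSpace ℝ (Fin 3) → EuclideanSpace ℝ (Fin 3)))
    (c : ℝ) (R : EuclideanSpace ℝ (Fin 3) ≃ₗᵢ[ℝ] EuclideanSpace ℝ (Fin 3)) : RotatedTypeIDSSLiouville c R :=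
  fun _ u hu hmeas _ hdec => hardness_unbounded_class hcrux u hu hmeas hdec

/-- **Hardness certificate for the crux**: `NoSelfExcitedDynamo` implies the catalogued open
conjecture `TypeIDSSLiouvilleConjecture` (Tsai, Conjectures 8.8–8.9 / Bradshaw–Tsai 2017, Open
Problem 5.1, canonical `@[conjecture]` leaf of this sub-problem). So the crux is at least as hard as
that conjecture, and a Type-I (rotated) DSS profile refutes it. -/
theorem typeIDSSLiouvilleConjecture_of_noSelfExcitedDynamo :
    Theses.HubbleDynamo.NoSelfExcitedDynamo → TypeIDSSLiouvilleConjecture :=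
  fun hcrux c => ⟨hardness_typeIDSSLiouville hcrux c, fun R => hardness_rotatedTypeIDSSLiouville hcrux c R⟩

/-- Contrapositive, for the disprover: a failure of `TypeIDSSLiouvilleConjecture` (e.g. any
`IsTypeIDSSProfile c R u`, via `IsTypeIDSSProfile.not_rotatedTypeIDSSLiouville`) refutes the crux. -/
theorem not_noSelfExcitedDynamo_of_not_typeIDSSLiouvilleConjecture
    (h : ¬ TypeIDSSLiouvilleConjecture) : ¬ Theses.HubbleDynamo.NoSelfExcitedDynamo :=
  fun hcrux => h (typeIDSSLiouvilleConjecture_of_noSelfExcitedDynamo hcrux)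

end Summit.NavierStokesRegularity.NavierStokesRegularity.Theorems.NoSelfExcitedDynamo.Registered

end
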